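/-
Origin: expansion seat `planner-pub-hodgecm-landherr-g9-0`, handover #3 2026-08-18T07:59:34Z (`HOME/pub-hodgecm-landherr-g9/lean/LandherrG9/HermLines.lean`, md5 c7ed6aaa, 131 lines);
landed by the gen-7 packager in gate run 26 as `HodgeCM/Proofs/LandherrLines.lean` (import ^import LandherrG9\.HermSpace3Godement\b→import HodgeCM.Proofs.LandherrGodement ×1).
-/
/-
Copyright: pub-hodgecm formalisation cell (harness21, 2026). New file (not vendored).
Origin: HOME/pub-hodgecm-landherr-g9/lean/LandherrG9/HermLines.lean — session
planner-pub-hodgecm-landherr-g9-0 (unit pub-hodgecm-landherr-g9, EXPANSION part (c) `Lemma33bLandherr`, gen 9).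
Intended final place: `HodgeCM/Proofs/LandherrLines.lean` (additive leaf; imports `HodgeCM.Proofs.LandherrGodement`
(= this seat's `LandherrG9/HermSpace3Godement.lean`, to land first); nothing in the package depends on it).
-/
import Summits.HodgeConjecture.HodgeCM.Proofs.LandherrGodement

set_option autoImplicit false

/-!
# PerL's hermitian lines `W_i` over the CM field — `IsLine`, `Anisotropic`, `Countable (unitary L)` by name

PerL v5 tex l. 230: `V₃ = W₁ ⊥ W₂ ⊥ W₃` with `dim_L W_i = 1`, `U(W_i) = U(1)`.  The doubling / Rallis seats
(`PerL34/{DoublingOrbit, RallisIP, RallisHaar, SiegelEv0, SiegelWeilGlue, DoublingBridge}.lean`) work over an ABSTRACT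
line: a field `L` with a `StarRing` structure, an `L`-module `W` with `(hW : IsLine L W)`, a sesquilinear
`h : Sesq L W` with `(hh : Anisotropic h)`, the rational points `U(W_i)(L₀) = unitary L` with `[Countable (unitary L)]`
(e.g. `RallisIP.N31e_holds`, `N31d.N31e_of_N31d`).  This file instantiates those binders over PerL's ACTUAL data —
the bundled CM field `L : CMField` with `star = conjRingHomK L` (the scoped instance `CMField.instStarRing` of
`Proofs/LandherrGodement.lean`) — so that each of them is dischargeable BY NAME:

* `CMField.instCountable : Countable L` (a number field is countable), hence `Countable (unitary L)`;
  `CMField.mem_unitary_iff : u ∈ unitary L ↔ conjRingHomK L u * u = 1` (`U(1)(L₀)` = the norm-one elements);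
* `CMField.lineSesq L a : Sesq L L`, `(x, y) ↦ σ(x)·a·y` — the hermitian line `⟨a⟩`; `CMField.isLine_self : IsLine L L`;
  **`CMField.anisotropic_lineSesq : a ≠ 0 → Anisotropic (lineSesq L a)`**;
* the lines INSIDE PerL's `(V₃, h)`: for `V : HermSpace3 L ι₁` and a vector `v`, the restriction of `h` to `L·v` is the
  line `⟨h(v,v)⟩` (`HermSpace3.sesq_smul_smul_eq_lineSesq`), and **`HermSpace3.anisotropic_line`**: if `[L:ℚ] ≠ 2` and
  `v ≠ 0` then `h(v,v) ≠ 0` and the line `⟨h(v,v)⟩` is anisotropic (from the isotropy dichotomy of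
  `Proofs/LandherrIsotropy.lean`).  Over an imaginary quadratic `L` a line `⟨a⟩`, `a ≠ 0`, is still anisotropic
  (`anisotropic_lineSesq` needs no degree hypothesis) — only `V₃` itself becomes isotropic.

Pure proof; nothing cited or posited; closures are the standard trio.
-/

noncomputable section

open NumberField
open Literature.AlgebraicGeometry.ShimuraVarieties

namespace HodgeCM

open CMField
open PerL34.Doubling (Sesq)
open PerL34.RallisIP (IsLine Anisotropic)

namespace CMField

variable (L : CMField)

/-- **A CM field is countable** (it is finite-dimensional over `ℚ`). -/
instance instCountable : Countable L :=
  Function.Injective.countable (Module.finBasis ℚ L).equivFun.injective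

/-- Hence PerL's `U(W_i)(L₀) = unitary L` is countable (the binder `[Countable (unitary L)]` of `RallisIP.N31e_holds`). -/
instance instCountableUnitary : Countable (unitary L) := inferInstance

/-- `U(1)(L₀)`: `u ∈ unitary L ↔ ū·u = 1` (norm one to `L⁺`). -/
theorem mem_unitary_iff (u : L) : u ∈ unitary L ↔ conjRingHomK L u * u = 1 := by
  rw [Unitary.mem_iff_star_mul_self, star_def]

/-- **The hermitian line `⟨a⟩`**: `W = L`, `h(x, y) = σ(x)·a·y`. -/
def lineSesq (a : L) : Sesq L L :=
  LinearMap.mk₂'ₛₗ (starRingEnd L) (RingHom.id L) (fun x y => conjRingHomK L x * a * y)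
    (fun x x' y => by rw [map_add]; ring)
    (fun c x y => by rw [starRingEnd_eq, smul_eq_mul, smul_eq_mul, map_mul]; ring)
    (fun x y y' => by ring)
    (fun c x y => by rw [RingHom.id_apply, smul_eq_mul, smul_eq_mul]; ring)

variable {L}

/-- (Ported verbatim from the HodgeCMPerL package; no docstring in the source.) -/
@[simp] theorem lineSesq_apply (a x y : L) : lineSesq L a x y = conjRingHomK L x * a * y := rfl

/-- `L` is a line over itself. -/
theorem isLine_self : IsLine L L := ⟨1, one_ne_zero, fun w => ⟨w, (mul_one w).symm⟩⟩

/-- **A hermitian line `⟨a⟩` with `a ≠ 0` is anisotropic**: `σ(x)·a·x = 0 ⇒ x = 0`. -/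
theorem anisotropic_lineSesq {a : L} (ha : a ≠ 0) : Anisotropic (lineSesq L a) := by
  intro x hx
  rw [lineSesq_apply] at hx
  rcases mul_eq_zero.mp hx with h | h
  · rcases mul_eq_zero.mp h with h | h
    · exact (map_eq_zero (conjRingHomK L)).mp h
    · exact (ha h).elim
  · exact h

/-- Conversely `⟨0⟩` is not anisotropic. -/
theorem not_anisotropic_lineSesq_zero : ¬ Anisotropic (lineSesq L 0) :=
  fun h => one_ne_zero (h 1 (by simp))

/-- (Ported verbatim from the HodgeCMPerL package; no docstring in the source.) -/
theorem anisotropic_lineSesq_iff (a : L) : Anisotropic (lineSesq L a) ↔ a ≠ 0 :=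
  ⟨fun h ha => not_anisotropic_lineSesq_zero (ha ▸ h), anisotropic_lineSesq⟩

end CMField

/-! ## The lines inside PerL's `(V₃, h)` -/

namespace HermSpace3

variable {L : CMField} {ι₁ : L →+* ℂ}

/-- The restriction of `h` to the line `L·v` is the hermitian line `⟨h(v,v)⟩`:
`h(x·v, y·v) = σ(x)·h(v,v)·y`. -/
theorem sesq_smul_smul_eq_lineSesq (V : HermSpace3 L ι₁) (v : Fin 3 → L) (x y : L) :
    V.sesq (x • v) (y • v) = CMField.lineSesq L (V.sesq v v) x y := by
  simp only [LinearMap.map_smulₛₗ, LinearMap.smul_apply, map_smul, smul_eq_mul, CMField.starRingEnd_eq,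
    CMField.lineSesq_apply]
  ring

/-- **PerL's lines are anisotropic**: for `[L:ℚ] ≠ 2` and `v ≠ 0`, `h(v,v) ≠ 0` … -/
theorem sesq_self_ne_zero (V : HermSpace3 L ι₁) (hL : Module.finrank ℚ L ≠ 2) {v : Fin 3 → L} (hv : v ≠ 0) :
    V.sesq v v ≠ 0 :=
  fun h0 => hv (anisotropic_sesq V hL v h0)

/-- … so the hermitian line `W = L·v ≅ ⟨h(v,v)⟩` is an anisotropic line (the binders `hW`, `hh` of the doubling
seats, over PerL's data). -/
theorem anisotropic_line (V : HermSpace3 L ι₁) (hL : Module.finrank ℚ L ≠ 2) {v : Fin 3 → L} (hv : v ≠ 0) :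
    IsLine L L ∧ Anisotropic (CMField.lineSesq L (V.sesq v v)) :=
  ⟨CMField.isLine_self, CMField.anisotropic_lineSesq (sesq_self_ne_zero V hL hv)⟩

/-- The diagonal entries `h(eᵢ, eᵢ) = Hmᵢᵢ` are the lines of the standard frame; in PerL's regime they are all
non-zero. -/
theorem Hm_diag_ne_zero (V : HermSpace3 L ι₁) (hL : Module.finrank ℚ L ≠ 2) (i : Fin 3) : V.Hm i i ≠ 0 := by
  rw [← hermForm_single_single (conjRingHomK L) V.Hm i i, ← sesq_apply]
  exact sesq_self_ne_zero V hL (Pi.single_ne_zero_iff.mpr one_ne_zero)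

end HermSpace3

end HodgeCM

end
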